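import Mathlib
import Summits.Ventures.HodgeRepro2.T5CompletionFundamentalIdentity
import Summits.Ventures.HodgeRepro2.T5CompletionDegree

/-!
# `[L_w : K_v] = 1 ↔ e(w∣v) = 1 ∧ f(w∣v) = 1` — the SPLIT dictionary (T5CompletionDegreeOne)

From `[L_w : K_v] = e(w∣v) · f(w∣v)` (T5CompletionFundamentalIdentity) and `e, f ≥ 1`: the completion at `w` is `K_v`
itself exactly when `w` is unramified with trivial residue extension — the print's «`v` splits in `E`» at the place
`w` (README §10.5(i)); T5EisensteinSplitPlace exhibits it at `ℚ(ζ₃)`, `7`.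

No axiom beyond the standard trio; nothing of the scored record changes.
§8(d): uses an L-value-free non-vanishing device: NO.
-/

namespace Summit.Ventures.HodgeRepro2.T5CompletionDegreeOne

open IsDedekindDomain HeightOneSpectrum NumberField

variable {K : Type*} [Field K] [NumberField K] (v : HeightOneSpectrum (NumberField.RingOfIntegers K))
  {L : Type*} [Field L] [NumberField L] [Algebra K L] (w : HeightOneSpectrum (NumberField.RingOfIntegers L))
  [w.asIdeal.LiesOver v.asIdeal]

/-- `f(w∣v) ≠ 0`. -/
theorem inertiaDeg'_ne_zero : v.asIdeal.inertiaDeg' w.asIdeal ≠ 0 := by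
  haveI : v.asIdeal.IsMaximal := v.isMaximal
  exact (Ideal.inertiaDeg'_pos v.asIdeal w.asIdeal).ne'

/-- THE SPLIT DICTIONARY: `[L_w : K_v] = 1 ↔ e(w∣v) = 1 ∧ f(w∣v) = 1`. -/
theorem finrank_eq_one_iff :
    Module.finrank (v.adicCompletion K) (w.adicCompletion L) = 1 ↔
      v.asIdeal.ramificationIdx' w.asIdeal = 1 ∧ v.asIdeal.inertiaDeg' w.asIdeal = 1 := by
  rw [Summit.Ventures.HodgeRepro2.T5CompletionFundamentalIdentity.finrank_eq_ramificationIdx'_mul_inertiaDeg',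
    mul_eq_one]

/-- `[L_w : K_v] = 1` as soon as `w` is unramified with trivial residue extension. -/
theorem finrank_eq_one_of (he : v.asIdeal.ramificationIdx' w.asIdeal = 1) (hf : v.asIdeal.inertiaDeg' w.asIdeal = 1) :
    Module.finrank (v.adicCompletion K) (w.adicCompletion L) = 1 :=
  (finrank_eq_one_iff v w).mpr ⟨he, hf⟩

/-- For a quadratic `L/K`: `[L_w : K_v] = 2` unless `w` is unramified with trivial residue extension. -/
theorem finrank_eq_two_of_not (hKL : Module.finrank K L = 2)
    (h : ¬ (v.asIdeal.ramificationIdx' w.asIdeal = 1 ∧ v.asIdeal.inertiaDeg' w.asIdeal = 1)) :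
    Module.finrank (v.adicCompletion K) (w.adicCompletion L) = 2 := by
  have h1 := Summit.Ventures.HodgeRepro2.T5CompletionDegree.finrank_le v w
  have h2 : 0 < Module.finrank (v.adicCompletion K) (w.adicCompletion L) := Module.finrank_pos
  rw [hKL] at h1
  have h3 : Module.finrank (v.adicCompletion K) (w.adicCompletion L) ≠ 1 := by
    rw [Ne, finrank_eq_one_iff]
    exact h
  omega

end Summit.Ventures.HodgeRepro2.T5CompletionDegreeOne
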